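import Literature.AlgebraicGeometry.Resolution.AlterationsSectionDivisor
import Literature.AlgebraicGeometry.Resolution.AlterationsFormalCoordinates
import Literature.AlgebraicGeometry.Resolution.StalkIdealLemmas
import Literature.RingTheory.KrullDimension.AffineCatenary
import HarnessLib

/-!
# De Jong's alteration theorem: the boundary of Situation 4.23 has strict normal crossings at the
# closed points of the smooth locus of `f` (de Jong 1996, 4.24)

Topic: `Literature/AlgebraicGeometry/Resolution`. The parenthesis of de Jong 1996, 4.24 — "(Of course
the sections `τᵢ` still map into the smooth locus of `f`; in fact, `Z` is already everywhere a
divisor with normal crossings, except in the singular points of `X`. …)" — at the points where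
`f` is SMOOTH, in Zariski-local (strict) form: for a pair in Situation 4.23
(`DeJong1996.SemiStablePair f g D τ`, `Z = ⋃ᵢ τᵢ(Y) ∪ f⁻¹(D)`) over an algebraically closed field
and a closed point `x` of an open `U` on which `f` is smooth, the local ring `B = 𝒪_{X,x}` has a
regular system of parameters `z₁, …, z_d` such that the stalk of the ideal of `Z` is
`(z₁ ⋯ z_r)`, `1 ≤ r ≤ d` (`DeJong1996.SemiStablePair.exists_rsop_stalkIdeal_boundary_of_smooth`).
With the formal coordinates of `AlterationsFormalCoordinates.lean` this gives the formal normal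
crossings of Situation 4.25 (i) at these points; the remaining points of 4.25 (i) — regular
closed points of `X` in `Sing(f)` — are the subject of 3.3 (`B ≅ A⟦u, v⟧/(uv - t₁)`).

The regular system of parameters (`A = 𝒪_{Y,f x}`, `φ = f_x^# : A → B`, `t₁, …, t_ρ, s₁, …` a
regular system of parameters of `A` with `I(D)_{f x} = (t₁ ⋯ t_ρ)`, from the definition of a strict
normal crossings divisor):

* if `x = τᵢ(y)` lies on a section: `z = (p, φ t, φ s)` where `(p) = ker(B → 𝒪_{Y,y})` is the
  (principal, `AlterationsSectionDivisor.lean`) germ of the ideal of `τᵢ(Y)`; indeed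
  `𝔪_B = (p) + φ(𝔪_A)B` because `τᵢ^# ∘ f^# = id` (`maximalIdeal_eq_ker_sup_map`); then
  `I(Z)_x = (p) ∩ √(φ(t₁ ⋯ t_ρ)) = (p · φt₁ ⋯ φt_ρ)`, `r = ρ + 1`;
* otherwise `z = (φ t, φ s, w)` with `w` lifting a uniformizer of the discrete valuation ring
  `B/𝔪_A B = 𝒪_{X_{f x}, x}` (the fibre is a curve, smooth at `x`); `𝔪_B = φ(𝔪_A)B + (w)`
  (`maximalIdeal_eq_map_sup_span_of_quotient`); `I(Z)_x = √(φ(t₁ ⋯ t_ρ)) = (φt₁ ⋯ φt_ρ)`, `r = ρ ≥ 1`.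

In both cases `d = dim B = dim A + 1` (`ringKrullDim_stalk_eq_add_one`) and the members of `z`
are pairwise non-associated primes of the factorial ring `B`, which makes the products radical.

With the formal coordinates adapted to `z` (`AlterationsFormalCoordinates.lean`) this yields the
FORMAL normal crossings of Situation 4.25 (i) at these points
(`DeJong1996.SemiStablePair.exists_ringEquiv_completedStalkIdeal_of_smooth`), so that the named
fact `DeJong1996SemiStableBoundaryNormalCrossings` (B2 of `AlterationsIsNormalFormParts.lean`)
reduces to its half at the regular closed points of `Sing(f)` — vendored here as the NAMED FACT
`DeJong1996SemiStableBoundaryNormalCrossingsSingF` (3.3 with `Σ nᵢ = 1`) — by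
`DeJong1996SemiStableBoundaryNormalCrossings.of_singF`; the target of the owning unit follows
from Lemma 3.2, this fact, and the two facts of 3.5
(`DeJong1996SemiStablePairNormalForm.of_lemma32_of_singF_of_nodal_of_components`).

## Sources

* A. J. de Jong, *Smoothness, semi-stability and alterations*, Publ. Math. IHÉS 83 (1996), 2.4,
  4.23–4.25 (pp. 55, 75).
* The Stacks Project, Tag 0BI9 (strict normal crossings, local form).
-/

noncomputable section

open CategoryTheory CategoryTheory.Limits AlgebraicGeometry TopologicalSpace Topology
  IsLocalRing

namespace Literature.AlgebraicGeometry.Resolution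

universe u

open Scheme.IdealSheafData

/-! ## Local algebra: generating the maximal ideal -/

/-- **Sections split the maximal ideal.** Let `φ : A' → B` and `ψ : B → A` be local homomorphisms
of local rings whose composite `ψ ∘ φ` is an isomorphism `κ : A' ≅ A`. Then
`𝔪_B = ker ψ + φ(𝔪_{A'}) B`. [folklore] -/
theorem maximalIdeal_eq_ker_sup_map {A' A B : Type*} [CommRing A'] [CommRing A] [CommRing B]
    [IsLocalRing A'] [IsLocalRing A] [IsLocalRing B] (φ : A' →+* B) (ψ : B →+* A) [IsLocalHom φ]
    [IsLocalHom ψ] (κ : A' ≃+* A) (h : ∀ a, ψ (φ a) = κ a) :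
    maximalIdeal B = RingHom.ker ψ ⊔ (maximalIdeal A').map φ := by
  apply le_antisymm
  · intro b hb
    set a := κ.symm (ψ b) with ha
    have hker : b - φ a ∈ RingHom.ker ψ := by
      rw [RingHom.mem_ker, map_sub, h, ha, RingEquiv.apply_symm_apply, sub_self]
    have hma : a ∈ maximalIdeal A' := by
      have hψb : ψ b ∈ maximalIdeal A := map_nonunit ψ b hb
      rw [mem_maximalIdeal, mem_nonunits_iff] at hψb ⊢
      intro hu
      apply hψb
      rw [ha] at hu
      simpa using hu.map κ
    have : b = (b - φ a) + φ a := by ring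
    rw [this]
    exact Ideal.add_mem _ (Ideal.mem_sup_left hker)
      (Ideal.mem_sup_right (Ideal.mem_map_of_mem φ hma))
  · refine sup_le (le_maximalIdeal (RingHom.ker_ne_top ψ)) ?_
    rw [Ideal.map_le_iff_le_comap]
    intro a ha
    rw [Ideal.mem_comap]
    exact map_nonunit φ a ha

/-- **Lifting a generator of the fibre's maximal ideal.** Let `B` be a local ring, `J ⊆ 𝔪_B` an
ideal, and suppose the maximal ideal of `B/J` is generated by the class of `w`. Then
`𝔪_B = J + (w)`. [folklore] -/
theorem maximalIdeal_eq_sup_span_of_quotient {B : Type*} [CommRing B] [IsLocalRing B]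
    {J : Ideal B} (hJ : J ≤ maximalIdeal B) [IsLocalRing (B ⧸ J)] (w : B)
    (hw : maximalIdeal (B ⧸ J) = Ideal.span {Ideal.Quotient.mk J w}) :
    maximalIdeal B = J ⊔ Ideal.span {w} := by
  haveI : IsLocalHom (Ideal.Quotient.mk J) :=
    IsLocalHom.of_surjective _ Ideal.Quotient.mk_surjective
  apply le_antisymm
  · intro b hb
    have hb' : Ideal.Quotient.mk J b ∈ maximalIdeal (B ⧸ J) := map_nonunit _ b hb
    rw [hw, Ideal.mem_span_singleton'] at hb'
    obtain ⟨c', hc'⟩ := hb'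
    obtain ⟨c, rfl⟩ := Ideal.Quotient.mk_surjective c'
    have hmem : b - c * w ∈ J := by
      rw [← Ideal.Quotient.eq_zero_iff_mem, map_sub, map_mul, hc', sub_self]
    have : b = (b - c * w) + c * w := by ring
    rw [this]
    exact Ideal.add_mem _ (Ideal.mem_sup_left hmem)
      (Ideal.mem_sup_right (Ideal.mul_mem_left _ c (Ideal.mem_span_singleton_self w)))
  · refine sup_le hJ ?_
    rw [Ideal.span_singleton_le_iff_mem]
    have hw' : Ideal.Quotient.mk J w ∈ maximalIdeal (B ⧸ J) :=
      hw ▸ Ideal.mem_span_singleton_self _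
    rw [mem_maximalIdeal, mem_nonunits_iff] at hw' ⊢
    exact fun hu => hw' (hu.map _)

/-- In a regular local ring of dimension one the maximal ideal is principal. [folklore] -/
theorem exists_maximalIdeal_eq_span_singleton_of_ringKrullDim_eq_one {F : Type*} [CommRing F]
    [IsRegularLocalRing F] (h : ringKrullDim F = 1) : ∃ w : F, maximalIdeal F = Ideal.span {w} := by
  obtain ⟨x₀, hx₀⟩ := exists_regularSystemOfParameters (R := F)
  have h1 : (maximalIdeal F).spanFinrank = 1 :=
    spanFinrank_maximalIdeal_eq_of_ringKrullDim_eq (d := 1) (by exact_mod_cast h)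
  obtain ⟨m, hm, x, hx⟩ : ∃ m : ℕ, m = 1 ∧ ∃ x : Fin m → F,
      Ideal.span (Set.range x) = maximalIdeal F := ⟨_, h1, x₀, hx₀⟩
  subst hm
  refine ⟨x 0, ?_⟩
  rw [← hx]
  congr 1
  ext a
  simp only [Set.mem_range, Set.mem_singleton_iff]
  constructor
  · rintro ⟨i, rfl⟩
    rw [Subsingleton.elim i 0]
  · rintro rfl
    exact ⟨0, rfl⟩

/-! ## Products over initial segments of `Fin` -/

/-- `∏_{i < r+1} (a, v)_i = a · ∏_{i < r} v_i`. [folklore] -/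
theorem Fin.prod_filter_lt_cons {M : Type*} [CommMonoid M] {n : ℕ} (a : M) (v : Fin n → M)
    (r : ℕ) :
    (∏ i ∈ Finset.univ.filter (fun i : Fin (n + 1) => i.val < r + 1), Fin.cons a v i) =
      a * ∏ i ∈ Finset.univ.filter (fun i : Fin n => i.val < r), v i := by
  rw [Finset.prod_filter, Finset.prod_filter, Fin.prod_univ_succ]
  simp only [Fin.val_zero, Nat.zero_lt_succ, ↓reduceIte, Fin.cons_zero, Fin.val_succ,
    Nat.succ_lt_succ_iff, Fin.cons_succ]

/-- `∏_{i < r} (t, w)_i = ∏ᵢ tᵢ` for `t` of length `r`. [folklore] -/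
theorem Fin.prod_filter_lt_append {M : Type*} [CommMonoid M] {r m : ℕ} (t : Fin r → M)
    (w : Fin m → M) :
    (∏ i ∈ Finset.univ.filter (fun i : Fin (r + m) => i.val < r), Fin.append t w i) = ∏ i, t i := by
  rw [Finset.prod_filter, Fin.prod_univ_add]
  simp only [Fin.val_castAdd, Fin.is_lt, ↓reduceIte, Fin.append_left, Fin.val_natAdd,
    add_lt_iff_neg_left, not_lt_zero, Finset.prod_const_one, mul_one]

/-- A cut inside the first block: `∏_{i < ρ} (t, w)_i = ∏_{i < ρ} tᵢ` for `t` of length `r ≥ ρ`.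
[folklore] -/
theorem Fin.prod_filter_lt_append_of_le {M : Type*} [CommMonoid M] {r m : ℕ} (t : Fin r → M)
    (w : Fin m → M) {ρ : ℕ} (hρ : ρ ≤ r) :
    (∏ i ∈ Finset.univ.filter (fun i : Fin (r + m) => i.val < ρ), Fin.append t w i) =
      ∏ i ∈ Finset.univ.filter (fun i : Fin r => i.val < ρ), t i := by
  rw [Finset.prod_filter, Finset.prod_filter, Fin.prod_univ_add]
  have h2 : ∀ j : Fin m, ¬ ((Fin.natAdd r j : Fin (r + m)).val < ρ) := fun j => by
    simp only [Fin.val_natAdd, not_lt]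
    exact hρ.trans (Nat.le_add_right _ _)
  simp only [Fin.val_castAdd, Fin.append_left, h2, ↓reduceIte, Finset.prod_const_one, mul_one]

/-! ## The dimension of the local ring at a closed point of a variety -/

/-- **At a closed point of a variety the local ring has the dimension of the variety**
(`dim 𝒪_{X,x} = dim X` for `x` closed in the integral scheme `X` of finite type over a field):
in an affine chart `U = Spec A ∋ x`, `x` is a maximal ideal `𝔪` (Nullstellensatz), so
`dim A_𝔪 = ht 𝔪 = dim A - dim A/𝔪 = dim A = dim X` by the dimension formula for affine domains
(`Literature.RingTheory.KrullDimension.ringKrullDim_quotient_add_height`).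
[cite: GortzWedhorn2020, Thm. 5.22] -/
theorem ringKrullDim_stalk_eq_of_isClosed {k : Type u} [Field k] {X : Scheme.{u}} [IsIntegral X]
    (f : X ⟶ Spec (.of k)) [LocallyOfFiniteType f] {x : X} (hx : IsClosed ({x} : Set X)) :
    ringKrullDim (X.presheaf.stalk x) = topologicalKrullDim X := by
  obtain ⟨U, hU, hxU, -⟩ :=
    exists_isAffineOpen_mem_and_subset (X := X) (x := x) (U := ⊤) (Opens.mem_top x)
  -- `Γ(X, U)` is an affine domain over `k`
  have hft : RingHom.FiniteType (f.appLE ⊤ U le_top).hom :=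
    HasRingHomProperty.appLE @LocallyOfFiniteType f ‹_› ⟨⊤, isAffineOpen_top _⟩ ⟨U, hU⟩ le_top
  let φ : k →+* Γ(X, U) := (f.appLE ⊤ U le_top).hom.comp (Scheme.ΓSpecIso (.of k)).inv.hom
  have hφ : φ.FiniteType :=
    hft.comp (RingHom.FiniteType.of_surjective _
      (Scheme.ΓSpecIso (.of k)).symm.commRingCatIsoToRingEquiv.surjective)
  letI : Algebra k Γ(X, U) := φ.toAlgebra
  haveI : Algebra.FiniteType k Γ(X, U) := hφ
  haveI : Nonempty U := ⟨⟨x, hxU⟩⟩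
  -- the maximal ideal of the closed point
  set 𝔪 := (hU.primeIdealOf ⟨x, hxU⟩).asIdeal with h𝔪
  haveI h𝔪max : 𝔪.IsMaximal := hU.primeIdealOf_isMaximal_of_isClosed ⟨x, hxU⟩ hx
  -- `dim 𝒪_{X,x} = ht 𝔪`
  letI := TopCat.Presheaf.algebra_section_stalk X.presheaf (⟨x, hxU⟩ : (U : X.Opens))
  haveI := hU.isLocalization_stalk ⟨x, hxU⟩
  have h1 : ringKrullDim (X.presheaf.stalk x) = 𝔪.height :=
    IsLocalization.AtPrime.ringKrullDim_eq_height 𝔪 (X.presheaf.stalk x)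
  -- `dim (A/𝔪) + ht 𝔪 = dim A`, `dim (A/𝔪) = 0`
  have h2 := Literature.RingTheory.KrullDimension.ringKrullDim_quotient_add_height k 𝔪
  letI : Field (Γ(X, U) ⧸ 𝔪) := Ideal.Quotient.field 𝔪
  have h3 : ringKrullDim (Γ(X, U) ⧸ 𝔪) = 0 := ringKrullDim_eq_zero_of_field _
  rw [h3, zero_add] at h2
  rw [h1, h2, topologicalKrullDim_eq_ringKrullDim_of_isAffineOpen f hU ⟨x, hxU⟩]

/-! ## The base: a regular system of parameters of `𝒪_{Y,y}` adapted to `D` -/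

namespace DeJong1996.SemiStablePair

variable {k : Type u} [Field k] {X Y : Scheme.{u}} {f : X ⟶ Y} {g : Y ⟶ Spec (.of k)}
  {D : Set Y} {n : ℕ} {τ : Fin n → (Y ⟶ X)}

/-- In Situation 4.23, at every point `y` of `Y` there is a regular system of parameters
`t₁, …, t_ρ, s₁, …, s_e` of `𝒪_{Y,y}` with `I(D)_y = (t₁ ⋯ t_ρ)` (the local form of the strict
normal crossings divisor `D` at `y ∈ D`, 2.4; any regular system of parameters and `ρ = 0` at
`y ∉ D`). [cite: DeJong1996, 2.4, p. 55] -/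
theorem exists_rsop_stalkIdeal_base (hS : SemiStablePair f g D τ) (y : Y) :
    ∃ (ρ e : ℕ) (t : Fin ρ → Y.presheaf.stalk y) (s : Fin e → Y.presheaf.stalk y),
      ringKrullDim (Y.presheaf.stalk y) = (ρ + e : ℕ) ∧
      Ideal.span (Set.range t ∪ Set.range s) = maximalIdeal (Y.presheaf.stalk y) ∧
      stalkIdeal (vanishingIdeal ⟨D, hS.isStrictNormalCrossingsDivisor.isClosed⟩) y =
        Ideal.span {∏ i, t i} ∧ (y ∈ D → 1 ≤ ρ) := by
  have hcl : (⟨closure D, isClosed_closure⟩ : Closeds Y) =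
      ⟨D, hS.isStrictNormalCrossingsDivisor.isClosed⟩ :=
    Closeds.ext hS.isStrictNormalCrossingsDivisor.isClosed.closure_eq
  by_cases hy : y ∈ D
  · obtain ⟨-, ρ, e, t, s, hρ, hdim, hspan, hI⟩ :=
      ((isStrictNormalCrossingsDivisor_iff_stalkIdeal Y D).mp hS.isStrictNormalCrossingsDivisor).2
        y hy
    rw [hcl] at hI
    exact ⟨ρ, e, t, s, hdim, hspan, hI, fun _ => hρ⟩
  · haveI := hS.isRegular_base y
    obtain ⟨s, hs⟩ := exists_regularSystemOfParameters (R := Y.presheaf.stalk y)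
    refine ⟨0, (maximalIdeal (Y.presheaf.stalk y)).spanFinrank, Fin.elim0, s, ?_, ?_, ?_,
      fun h => (hy h).elim⟩
    · have h := IsRegularLocalRing.spanFinrank_maximalIdeal (R := Y.presheaf.stalk y)
      rw [zero_add]
      exact_mod_cast h.symm
    · rw [Set.range_eq_empty Fin.elim0, Set.empty_union, hs]
    · rw [Finset.univ_eq_empty, Finset.prod_empty, Ideal.span_singleton_one]
      apply stalkIdeal_eq_top_of_not_mem_support
      rw [← SetLike.mem_coe, coe_support_vanishingIdeal]
      exact hy

/-! ## The stalk of the ideal of the boundary -/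

/-- The boundary of Situation 4.23 as a join of closed subsets. [folklore] -/
theorem closeds_semiStableBoundary_eq (hS : SemiStablePair f g D τ) :
    (⟨semiStableBoundary f D τ, hS.isClosed_semiStableBoundary⟩ : Closeds X) =
      (Finset.univ.sup fun i => (⟨Set.range (τ i),
        (hS.isClosedImmersion i).isClosedEmbedding.isClosed_range⟩ : Closeds X)) ⊔
        (⟨D, hS.isStrictNormalCrossingsDivisor.isClosed⟩ : Closeds Y).preimage f.continuous := by
  ext1
  rw [Closeds.coe_sup, Closeds.coe_preimage, Closeds.coe_finset_sup, Finset.sup_set_eq_biUnion]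
  change semiStableBoundary f D τ = _ ∪ f ⁻¹' D
  rw [semiStableBoundary]
  congr 1
  ext x
  simp

/-- Off a section its ideal has unit stalk. [folklore] -/
theorem stalkIdeal_vanishingIdeal_range_eq_top (hS : SemiStablePair f g D τ) (i : Fin n) {x : X}
    (hx : x ∉ Set.range (τ i)) :
    stalkIdeal (vanishingIdeal
      ⟨Set.range (τ i), (hS.isClosedImmersion i).isClosedEmbedding.isClosed_range⟩) x = ⊤ := by
  apply stalkIdeal_eq_top_of_not_mem_support
  rw [← SetLike.mem_coe, coe_support_vanishingIdeal]
  exact hx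

/-- On a section, the stalk of its ideal is the kernel of the stalk map (a prime of the local
ring). [folklore] -/
theorem stalkIdeal_vanishingIdeal_range_self (hS : SemiStablePair f g D τ) (i : Fin n) (y : Y) :
    stalkIdeal (vanishingIdeal
      ⟨Set.range (τ i), (hS.isClosedImmersion i).isClosedEmbedding.isClosed_range⟩) (τ i y) =
      RingHom.ker ((τ i).stalkMap y).hom := by
  haveI := hS.isClosedImmersion i
  haveI := hS.isIntegral_base
  haveI : IsDomain (Y.presheaf.stalk y) :=
    haveI := hS.isRegular_base y
    isDomain_of_isRegularLocalRing _
  have hsupp : (⟨Set.range (τ i), (hS.isClosedImmersion i).isClosedEmbedding.isClosed_range⟩ :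
      Closeds X) = (τ i).ker.support := by
    ext1
    rw [Scheme.Hom.support_ker, (τ i).isClosedEmbedding.isClosed_range.closure_eq]
    rfl
  rw [hsupp, vanishingIdeal_support, stalkIdeal_radical, stalkIdeal_ker_eq_ker_stalkMap]
  exact (RingHom.ker_isPrime _).radical

/-- The stalk of the ideal of the boundary: `I(Z)_x = (⋂ⱼ I(τⱼ(Y))_x) ∩ I(f⁻¹D)_x`. [folklore] -/
theorem stalkIdeal_vanishingIdeal_semiStableBoundary (hS : SemiStablePair f g D τ) (x : X) :
    stalkIdeal (vanishingIdeal ⟨semiStableBoundary f D τ, hS.isClosed_semiStableBoundary⟩) x =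
      (Finset.univ.inf fun i => stalkIdeal (vanishingIdeal
          ⟨Set.range (τ i), (hS.isClosedImmersion i).isClosedEmbedding.isClosed_range⟩) x) ⊓
        stalkIdeal (vanishingIdeal ((⟨D, hS.isStrictNormalCrossingsDivisor.isClosed⟩ :
          Closeds Y).preimage f.continuous)) x := by
  rw [hS.closeds_semiStableBoundary_eq, vanishingIdeal_sup, stalkIdeal_inf,
    Finset.sup_univ_eq_iSup, vanishingIdeal_iSup, ← Finset.inf_univ_eq_iInf,
    stalkIdeal_finset_inf]

/-! ## The regular system of parameters at a closed point of the smooth locus -/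

/-- **de Jong 1996, 4.24: "`Z` is already everywhere a divisor with normal crossings, except in
the singular points of `X`" — at the closed points of the smooth locus of `f`, in strict
Zariski-local form.** For a pair in Situation 4.23 over an algebraically closed field, `dim X = d`,
and a closed point `x` of an open on which `f` is smooth, lying on `Z`: the local ring `𝒪_{X,x}`
(regular of dimension `d`) has generators `z₁, …, z_d` of its maximal ideal such that the stalk
of the ideal of `Z = ⋃ᵢ τᵢ(Y) ∪ f⁻¹(D)` is `(z₁ ⋯ z_r)` with `1 ≤ r ≤ d`. (On a section:
`z = (p, f^#t, f^#s)`, `I(Z)_x = (p · f^#t₁ ⋯ f^#t_ρ)`; off the sections: `z = (f^#t, f^#s, w)`,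
`I(Z)_x = (f^#t₁ ⋯ f^#t_ρ)`; see the module docstring.) [cite: DeJong1996, 4.24, p. 75] -/
theorem exists_rsop_stalkIdeal_boundary_of_smooth [IsAlgClosed k] (hS : SemiStablePair f g D τ)
    {d : ℕ} (hd : topologicalKrullDim X = d) {U : X.Opens} (hU : Smooth (U.ι ≫ f)) {x : X}
    (hxU : x ∈ U) (hx : IsClosed ({x} : Set X)) (hxZ : x ∈ semiStableBoundary f D τ) :
    ∃ (z : Fin d → X.presheaf.stalk x) (r : ℕ), 1 ≤ r ∧ r ≤ d ∧
      Ideal.span (Set.range z) = maximalIdeal (X.presheaf.stalk x) ∧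
      ringKrullDim (X.presheaf.stalk x) = d ∧
      stalkIdeal (vanishingIdeal ⟨semiStableBoundary f D τ, hS.isClosed_semiStableBoundary⟩) x =
        Ideal.span {∏ i ∈ Finset.univ.filter (fun i : Fin d => i.val < r), z i} := by
  classical
  haveI := hS.isIntegral
  haveI := hS.locallyOfFiniteType
  haveI := hS.isNoetherian_base
  -- `B = 𝒪_{X,x}` regular of dimension `d`, `A = 𝒪_{Y,f x}`, `φ = f_x^#`
  haveI hB : IsRegularLocalRing (X.presheaf.stalk x) := hS.isRegularLocalRing_of_smooth hU hxU
  haveI : IsDomain (X.presheaf.stalk x) := isDomain_of_isRegularLocalRing _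
  have hdimB : ringKrullDim (X.presheaf.stalk x) = d := by
    rw [ringKrullDim_stalk_eq_of_isClosed (f ≫ g) hx, hd]
  set φ := (f.stalkMap x).hom with hφ
  haveI : IsLocalHom φ := inferInstanceAs (IsLocalHom (f.stalkMap x).hom)
  -- the base data at `f x`
  obtain ⟨ρ, e, t, s, hdimA, hspanA, hIA, hρ⟩ := hS.exists_rsop_stalkIdeal_base (f x)
  -- `d = ρ + e + 1`
  have hdAB := hS.ringKrullDim_stalk_eq_add_one hU hxU hx
  rw [hdimB, hdimA] at hdAB
  obtain rfl : d = ρ + e + 1 := by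
    have h1 : ((d : ℕ∞) : WithBot ℕ∞) = ((ρ + e : ℕ) : ℕ∞) + 1 := by exact_mod_cast hdAB
    have h2 : (d : ℕ∞) = (ρ + e : ℕ) + 1 := by exact_mod_cast h1
    exact_mod_cast h2
  -- the stalk of the ideal of `f⁻¹(D)` at `x`
  set t' : Fin ρ → X.presheaf.stalk x := fun i => φ (t i) with ht'
  set s' : Fin e → X.presheaf.stalk x := fun i => φ (s i) with hs'
  have hID : stalkIdeal (vanishingIdeal ((⟨D, hS.isStrictNormalCrossingsDivisor.isClosed⟩ :
      Closeds Y).preimage f.continuous)) x = (Ideal.span {∏ i, t' i}).radical := by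
    rw [stalkIdeal_vanishingIdeal_preimage, hIA, Ideal.map_span, Set.image_singleton, map_prod]
  have hmapA : (maximalIdeal (Y.presheaf.stalk (f x))).map φ =
      Ideal.span (Set.range t' ∪ Set.range s') := by
    rw [← hspanA, Ideal.map_span, Set.image_union, ← Set.range_comp, ← Set.range_comp]
    rfl
  by_cases hsec : ∃ i, x ∈ Set.range (τ i)
  · /- Case A: `x = τᵢ(y)` lies on a section -/
    obtain ⟨i, y, rfl⟩ := hsec
    haveI := hS.isClosedImmersion i
    -- `(p) = ker ψ`, `ψ = τᵢ^#`
    set ψ := ((τ i).stalkMap y).hom with hψ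
    haveI : IsLocalHom ψ := inferInstanceAs (IsLocalHom ((τ i).stalkMap y).hom)
    obtain ⟨p, hp0, hPp⟩ := hS.exists_stalkIdeal_ker_eq_span_singleton i y hx
    have hker : RingHom.ker ψ = Ideal.span {p} := by
      rw [← stalkIdeal_ker_eq_ker_stalkMap, hPp]
    -- `ψ ∘ φ` is the isomorphism `𝒪_{Y, f(τ y)} ≅ 𝒪_{Y,y}`
    have hcomp : (τ i ≫ f).stalkMap y = f.stalkMap (τ i y) ≫ (τ i).stalkMap y :=
      Scheme.Hom.stalkMap_comp (τ i) f y
    rw [Scheme.Hom.stalkMap_congr_hom (τ i ≫ f) (𝟙 Y) (hS.comp_eq_id i) y] at hcomp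
    let κ := (Y.presheaf.stalkCongr (.of_eq <| (hS.comp_eq_id i) ▸ rfl) :
      Y.presheaf.stalk ((τ i ≫ f) y) ≅ Y.presheaf.stalk ((𝟙 Y : Y ⟶ Y) y)).commRingCatIsoToRingEquiv
    have hψφ : ∀ a, ψ (φ a) = κ a := fun a => by
      have h := congrArg (fun h => h.hom a) hcomp
      simp only [CommRingCat.hom_comp, RingHom.comp_apply, Scheme.Hom.stalkMap_id] at h
      exact h.symm
    -- `𝔪_B = (p) + φ(𝔪_A) B`
    have hmB : maximalIdeal (X.presheaf.stalk (τ i y)) =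
        Ideal.span ({p} ∪ (Set.range t' ∪ Set.range s')) := by
      rw [maximalIdeal_eq_ker_sup_map φ ψ κ hψφ, hker, hmapA, ← Ideal.span_union]
    -- the regular system of parameters `z = (p, t', s')`
    let z : Fin (ρ + e + 1) → X.presheaf.stalk (τ i y) := Fin.cons p (Fin.append t' s')
    have hz : Ideal.span (Set.range z) = maximalIdeal _ := by
      rw [hmB, Fin.range_cons, range_fin_append, Set.insert_eq]
    have hdimB' : ringKrullDim (X.presheaf.stalk (τ i y)) = ((ρ + e + 1 : ℕ) : ℕ) := hdimB
    -- the members of `z` are pairwise non-associated primes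
    have hzp : ∀ j, Prime (z j) := fun j => prime_of_rsop z hz hdimB' j
    have hzn : ∀ j j', j ≠ j' → ¬ z j ∣ z j' := fun j j' h => not_dvd_of_rsop z hz hdimB' h
    have ht'z : ∀ j : Fin ρ, t' j = z (Fin.succ (Fin.castAdd e j)) := fun j => by
      simp only [z, Fin.cons_succ, Fin.append_left]
    have hpz : p = z 0 := rfl
    have ht'p : ∀ j : Fin ρ, Prime (t' j) := fun j => (ht'z j).symm ▸ hzp _
    have ht'n : ∀ j ∈ (Finset.univ : Finset (Fin ρ)), ∀ j' ∈ (Finset.univ : Finset (Fin ρ)),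
        j ≠ j' → ¬ t' j ∣ t' j' := fun j _ j' _ hjj' => by
      rw [ht'z, ht'z]
      exact hzn _ _ (fun h => hjj' (Fin.castAdd_injective _ _ (Fin.succ_injective _ h)))
    -- `I(f⁻¹D)_x = (t'₁ ⋯ t'_ρ)`
    have hrad : (Ideal.span {∏ j, t' j}).radical = Ideal.span {∏ j, t' j} :=
      Ideal.radical_span_singleton_prod_eq t' Finset.univ (fun j _ => ht'p j) ht'n
    -- `I(Z)_x = (p) ∩ (∏ t') = (p ∏ t')`
    have hsecs : (Finset.univ.inf fun j => stalkIdeal (vanishingIdeal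
        ⟨Set.range (τ j), (hS.isClosedImmersion j).isClosedEmbedding.isClosed_range⟩) (τ i y)) =
        Ideal.span {p} := by
      apply le_antisymm
      · refine (Finset.inf_le (Finset.mem_univ i)).trans ?_
        rw [hS.stalkIdeal_vanishingIdeal_range_self i y, hker]
      · refine Finset.le_inf fun j _ => ?_
        by_cases hji : j = i
        · subst hji
          rw [hS.stalkIdeal_vanishingIdeal_range_self j y, hker]
        · rw [hS.stalkIdeal_vanishingIdeal_range_eq_top j]
          · exact le_top
          · intro hmem
            exact Set.disjoint_left.mp (hS.pairwise_disjoint (Ne.symm hji)) ⟨y, rfl⟩ hmem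
    have hinf : Ideal.span {p} ⊓ Ideal.span {∏ j, t' j} = Ideal.span {p * ∏ j, t' j} :=
      Ideal.span_singleton_inf_span_singleton_prod t' Finset.univ (fun j _ => ht'p j) ht'n
        (hpz ▸ hzp 0) (fun j _ => by rw [hpz, ht'z]; exact hzn _ _ (Fin.succ_ne_zero _).symm)
    refine ⟨z, ρ + 1, Nat.succ_le_succ (Nat.zero_le ρ), by omega, hz, hdimB', ?_⟩
    rw [hS.stalkIdeal_vanishingIdeal_semiStableBoundary, hsecs, hID, hrad, hinf]
    refine congrArg (fun a => Ideal.span {a}) ?_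
    change p * ∏ j ∈ Finset.univ, t' j =
      ∏ j ∈ Finset.univ.filter (fun j : Fin (ρ + e + 1) => j.val < ρ + 1),
        Fin.cons p (Fin.append t' s') j
    rw [Fin.prod_filter_lt_cons, Fin.prod_filter_lt_append]
  · /- Case B: `x` lies on no section, hence on `f⁻¹(D)` -/
    push Not at hsec
    have hxD : f x ∈ D := by
      rcases (mem_semiStableBoundary_iff f D τ x).mp hxZ with ⟨i, hi⟩ | h
      · exact (hsec i hi).elim
      · exact h
    have hρ1 : 1 ≤ ρ := hρ hxD
    -- the fibre ring `B/𝔪_A B = 𝒪_{X_{f x}, x}` is a discrete valuation ring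
    obtain ⟨eF⟩ := Literature.AlgebraicGeometry.Motives.nonempty_stalkFiber_ringEquiv_asFiber f x
    haveI hFreg : IsRegularLocalRing
        (X.presheaf.stalk x ⧸ (maximalIdeal (Y.presheaf.stalk (f x))).map φ) :=
      haveI := isRegularLocalRing_stalk_fiber_of_smooth f hU hxU
      IsRegularLocalRing.of_ringEquiv eF
    have hFdim : ringKrullDim
        (X.presheaf.stalk x ⧸ (maximalIdeal (Y.presheaf.stalk (f x))).map φ) = 1 := by
      rw [← ringKrullDim_eq_of_ringEquiv eF, hS.ringKrullDim_stalk_fiber_eq_one hU hxU hx]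
    obtain ⟨w', hw'⟩ := exists_maximalIdeal_eq_span_singleton_of_ringKrullDim_eq_one hFdim
    obtain ⟨w, rfl⟩ := Ideal.Quotient.mk_surjective w'
    have hJm : (maximalIdeal (Y.presheaf.stalk (f x))).map φ ≤ maximalIdeal (X.presheaf.stalk x) := by
      rw [Ideal.map_le_iff_le_comap]
      intro a ha
      exact map_nonunit φ a ha
    -- `𝔪_B = φ(𝔪_A) B + (w)`
    have hmB : maximalIdeal (X.presheaf.stalk x) =
        Ideal.span ((Set.range t' ∪ Set.range s') ∪ {w}) := by
      have h := maximalIdeal_eq_sup_span_of_quotient hJm w hw'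
      rw [hmapA] at h
      rw [h, ← Ideal.span_union]
    -- the regular system of parameters `z = (t', s', w)`, reindexed to `Fin (ρ + e + 1)`
    set ε : Fin (ρ + e + 1) ≃ Fin (ρ + (e + 1)) := finCongr (Nat.add_assoc ρ e 1) with hε
    let z₀ : Fin (ρ + (e + 1)) → X.presheaf.stalk x :=
      Fin.append t' (Fin.append s' (fun _ : Fin 1 => w))
    let z : Fin (ρ + e + 1) → X.presheaf.stalk x := z₀ ∘ ε
    have hrange : Set.range z = Set.range z₀ := ε.surjective.range_comp z₀
    have hz : Ideal.span (Set.range z) = maximalIdeal _ := by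
      rw [hrange, hmB]
      simp only [z₀, range_fin_append, Set.range_const, Set.union_assoc]
    have hzp : ∀ j, Prime (z j) := fun j => prime_of_rsop z hz hdimB j
    have hzn : ∀ j j', j ≠ j' → ¬ z j ∣ z j' := fun j j' h => not_dvd_of_rsop z hz hdimB h
    have ht'z : ∀ j : Fin ρ, t' j = z (ε.symm (Fin.castAdd (e + 1) j)) := fun j => by
      simp only [z, z₀, Function.comp_apply, Equiv.apply_symm_apply, Fin.append_left]
    have ht'p : ∀ j : Fin ρ, Prime (t' j) := fun j => (ht'z j).symm ▸ hzp _
    have ht'n : ∀ j ∈ (Finset.univ : Finset (Fin ρ)), ∀ j' ∈ (Finset.univ : Finset (Fin ρ)),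
        j ≠ j' → ¬ t' j ∣ t' j' := fun j _ j' _ hjj' => by
      rw [ht'z, ht'z]
      exact hzn _ _ (fun h => hjj' (Fin.castAdd_injective _ _ (ε.symm.injective h)))
    have hrad : (Ideal.span {∏ j, t' j}).radical = Ideal.span {∏ j, t' j} :=
      Ideal.radical_span_singleton_prod_eq t' Finset.univ (fun j _ => ht'p j) ht'n
    have hsecs : (Finset.univ.inf fun j => stalkIdeal (vanishingIdeal
        ⟨Set.range (τ j), (hS.isClosedImmersion j).isClosedEmbedding.isClosed_range⟩) x) = ⊤ := by
      refine le_antisymm le_top (Finset.le_inf fun j _ => ?_)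
      rw [hS.stalkIdeal_vanishingIdeal_range_eq_top j (hsec j)]
    refine ⟨z, ρ, hρ1, by omega, hz, hdimB, ?_⟩
    rw [hS.stalkIdeal_vanishingIdeal_semiStableBoundary, hsecs, top_inf_eq, hID, hrad]
    refine congrArg (fun a => Ideal.span {a}) ?_
    rw [Finset.prod_filter]
    have hF : ∀ j : Fin (ρ + e + 1), (if j.val < ρ then z j else 1) =
        (fun i : Fin (ρ + (e + 1)) => if i.val < ρ then z₀ i else 1) (ε j) := fun j => by
      simp only [z, Function.comp_apply, hε, finCongr_apply, Fin.val_cast]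
    simp_rw [hF]
    rw [Equiv.prod_comp ε (fun i : Fin (ρ + (e + 1)) => if i.val < ρ then z₀ i else 1),
      ← Finset.prod_filter]
    change ∏ j ∈ Finset.univ, t' j =
      ∏ j ∈ Finset.univ.filter (fun j : Fin (ρ + (e + 1)) => j.val < ρ),
        Fin.append t' (Fin.append s' (fun _ : Fin 1 => w)) j
    rw [Fin.prod_filter_lt_append]

/-! ## Formal normal crossings at the closed points of the smooth locus -/

/-- **de Jong 1996, 4.25 (i) at the closed points of the smooth locus of `f` — PROVED**: for a
pair in Situation 4.23 over an algebraically closed field `k` with `dim X = d` and a closed point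
`x ∈ Z` of an open on which `f` is smooth, there are `1 ≤ r ≤ d` and an isomorphism
`𝒪̂_{X,x} ≅ k⟦X₁, …, X_d⟧` carrying the completed ideal of `Z` to `(X₁ ⋯ X_r)`
(`exists_rsop_stalkIdeal_boundary_of_smooth` with the formal coordinates adapted to the regular
system of parameters, `exists_ringEquiv_adicCompletion_stalk_mvPowerSeries`).
[cite: DeJong1996, 4.24–4.25, p. 75] -/
theorem exists_ringEquiv_completedStalkIdeal_of_smooth [IsAlgClosed k]
    (hS : SemiStablePair f g D τ) {d : ℕ} (hd : topologicalKrullDim X = d) {U : X.Opens}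
    (hU : Smooth (U.ι ≫ f)) {x : X} (hxU : x ∈ U) (hx : IsClosed ({x} : Set X))
    (hxZ : x ∈ semiStableBoundary f D τ) :
    ∃ r : ℕ, 1 ≤ r ∧ r ≤ d ∧
      ∃ e : AdicCompletion (maximalIdeal (X.presheaf.stalk x)) (X.presheaf.stalk x) ≃+*
          MvPowerSeries (Fin d) k,
        ∀ (U' : X.affineOpens) (hU' : x ∈ (U' : X.Opens)),
          (completedStalkIdeal (vanishingIdeal ⟨semiStableBoundary f D τ,
              hS.isClosed_semiStableBoundary⟩) x U' hU').map e.toRingHom =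
            Ideal.span {normalCrossingsEquation k d r} := by
  haveI := hS.locallyOfFiniteType
  haveI : IsRegularLocalRing (X.presheaf.stalk x) := hS.isRegularLocalRing_of_smooth hU hxU
  obtain ⟨z, r, hr1, hrd, hz, hdimB, hI⟩ :=
    hS.exists_rsop_stalkIdeal_boundary_of_smooth hd hU hxU hx hxZ
  obtain ⟨e, he⟩ := exists_ringEquiv_adicCompletion_stalk_mvPowerSeries (f ≫ g) hx z hz hdimB
  exact ⟨r, hr1, hrd, e, fun U' hU' =>
    completedStalkIdeal_map_eq_span_normalCrossingsEquation z r e he _ hI U' hU'⟩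

end DeJong1996.SemiStablePair

/-! ## B2 from its half at the regular points of `Sing(f)` -/

open DeJong1996 in
/-- NAMED FACT — **de Jong 1996, 3.3 (the case `Σ nᵢ = 1`): formal normal crossings of the
boundary at the regular closed points of `X` lying in `Sing(f)`.** The remaining half of
`DeJong1996SemiStableBoundaryNormalCrossings` (B2 of `AlterationsIsNormalFormParts.lean`, whose
other half — the points of the smooth locus of `f` — is
`DeJong1996.SemiStablePair.exists_ringEquiv_completedStalkIdeal_of_smooth`): for a pair in
Situation 4.23 over an algebraically closed field with `dim X = d`, at a closed point `x ∈ Z` with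
`𝒪_{X,x}` regular but `f` smooth on no neighbourhood of `x`, there are `1 ≤ r ≤ d` and an
isomorphism `𝒪̂_{X,x} ≅ k⟦x₁, …, x_d⟧` carrying the completed ideal of `Z` to `(x₁ ⋯ x_r)`. In the
source this is 3.3: "`B ≅ A'⟦u, v⟧/(Q - h)` … `h = ε t₁^{n₁} ⋯ t_r^{n_r}` … (if `Σ nᵢ = 1`, then the
point `x` is regular on `X`)", i.e. `𝒪̂_{X,x} ≅ k⟦t₁, …, t_{d-1}⟧⟦u, v⟧/(uv - t₁) ≅
k⟦u, v, t₂, …, t_{d-1}⟧` with `Z = f⁻¹(D) = {uv · t₂ ⋯ t_ρ = 0}` (such a point lies on no section,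
the sections mapping into the smooth locus). Users take
`(h : DeJong1996SemiStableBoundaryNormalCrossingsSingF)`; it is the node carrying the local
structure of nodes (2.23) over a regular base. [cite: DeJong1996, 3.3 and 4.24, pp. 63, 75] -/
def DeJong1996SemiStableBoundaryNormalCrossingsSingF : Prop :=
  ∀ (k : Type u) [Field k] [IsAlgClosed k] (X Y : Scheme.{u}) (f : X ⟶ Y)
    (g : Y ⟶ Spec (.of k)) (D : Set Y) (n : ℕ) (τ : Fin n → (Y ⟶ X)) (d : ℕ)
    (hS : DeJong1996.SemiStablePair f g D τ), topologicalKrullDim X = d →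
      ∀ x : X, IsClosed ({x} : Set X) → IsRegularLocalRing (X.presheaf.stalk x) →
        x ∈ DeJong1996.semiStableBoundary f D τ →
          (∀ U : X.Opens, x ∈ U → ¬ Smooth (U.ι ≫ f)) →
          ∃ r : ℕ, 1 ≤ r ∧ r ≤ d ∧
            ∃ e : AdicCompletion (maximalIdeal (X.presheaf.stalk x)) (X.presheaf.stalk x) ≃+*
                MvPowerSeries (Fin d) k,
              ∀ (U : X.affineOpens) (hU : x ∈ (U : X.Opens)),
                (completedStalkIdeal (vanishingIdeal ⟨DeJong1996.semiStableBoundary f D τ,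
                    hS.isClosed_semiStableBoundary⟩) x U hU).map e.toRingHom =
                  Ideal.span {DeJong1996.normalCrossingsEquation k d r}

/-- **B2 from its two halves**: the formal normal crossings of the boundary at the nonsingular
closed points (`DeJong1996SemiStableBoundaryNormalCrossings`) follow from the PROVED case of the
smooth locus of `f` and the named fact for the regular points of `Sing(f)`.
[cite: DeJong1996, 4.24, p. 75] -/
theorem DeJong1996SemiStableBoundaryNormalCrossings.of_singF
    (h : DeJong1996SemiStableBoundaryNormalCrossingsSingF.{u}) :
    DeJong1996SemiStableBoundaryNormalCrossings.{u} := by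
  intro k _ _ X Y f g D n τ d hS hd x hx hreg hxZ
  by_cases hsm : ∃ U : X.Opens, x ∈ U ∧ Smooth (U.ι ≫ f)
  · obtain ⟨U, hxU, hU⟩ := hsm
    exact hS.exists_ringEquiv_completedStalkIdeal_of_smooth hd hU hxU hx hxZ
  · push Not at hsm
    exact h k X Y f g D n τ d hS hd x hx hreg hxZ hsm

/-- Sanity: the new fact is implied back by B2 (it is B2 under an extra hypothesis).
[folklore] -/
theorem DeJong1996SemiStableBoundaryNormalCrossingsSingF.of_normalCrossings
    (h : DeJong1996SemiStableBoundaryNormalCrossings.{u}) :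
    DeJong1996SemiStableBoundaryNormalCrossingsSingF.{u} :=
  fun k _ _ X Y f g D n τ d hS hd x hx hreg hxZ _ => h k X Y f g D n τ d hS hd x hx hreg hxZ

/-- The target of the owning unit, 4.24 in sufficiency form, from the remaining leaves: Lemma 3.2
as printed, 3.3 (`Σ nᵢ = 1`) at the regular points of `Sing(f)`, 3.5 (nodal form), 3.5
(singular components regular). [cite: DeJong1996, 4.24, p. 75] -/
theorem DeJong1996SemiStablePairNormalForm.of_lemma32_of_singF_of_nodal_of_components
    (hA : DeJong1996Lemma32.{u}) (h₂ : DeJong1996SemiStableBoundaryNormalCrossingsSingF.{u})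
    (h₃ : DeJong1996CodimThreeNodalForm.{u})
    (h₅ : DeJong1996CodimThreeSingularComponentsRegular.{u}) :
    DeJong1996SemiStablePairNormalForm.{u} :=
  DeJong1996SemiStablePairNormalForm.of_lemma32_of_local hA
    (DeJong1996SemiStableBoundaryNormalCrossings.of_singF h₂) h₃ h₅

end Literature.AlgebraicGeometry.Resolution

end
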